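/-
Copyright: the b2b-balaban T⁴-continuum CRUX team, row NE7b, leaf lineage `t4-ne7b-formalise-leaf-02` (gen 133). Project licence.
-/
import Summits.QuantumFields.BalabanUV.T4Continuum.Spine.NE7b.OneStepCurlFormDisplay

/-!
# PROP. 5.4, FIRST DISPLAY, AT ONE STEP — IN PRINT's `η`-UNITS: with `η = L⁻¹` (the fine spacing when the coarse lattice is the unit lattice),
# the unit-lattice field `B = L(Q(V₀)A)` (the un-normalised linear one-step average (122)), `‖D_UA‖²_{L²(η)} := η^d Σ_q (η⁻²‖F_A(q)‖)²` and
# `‖A‖²_{L²(η)} := η^d Σ_b (η⁻¹‖A(b)‖)²`: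
# `F(B) = Σ_P ‖∂̄_{V̄₀}B(P)‖² ≤ 4(1+2Lα₀)²·‖D_UA‖²_{L²(η)} + (8(d−1)(L+2)²ε₁² + 32d(d−1)L^d(50(d+1)ε₂)²)·‖A‖²_{L²(η)}`
# — `…OneStepCurlFormDisplay.sum_sq_X_linQcov_le'` rescaled: the curl functional is absolutely homogeneous, `Σ_q F_q² = L^{d−4}‖D_UA‖²_{L²(η)}`,
# `Σ_b A_b² = L^{d−2}‖A‖²_{L²(η)}` (row NE7b, node U5c; `HOME/b2b-balaban-r1/SectE-interface-proof.md` §5.4 ∕ (5.2) in print's normalisation: «`F(QA) ≤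
# 16‖D_UA‖² + c₃ε_F²‖A‖²_{L²(Ω_k)}`», the `hF` letter `(p, q)` of `…CurlFormEnergyDomination.h1_of_letters`; E-side key reading — the `L²(η)` NORMALISATION
# of this lineage's `k = 1` display (g132's (cc″)(1), last clause): `p = 4(1+2Lα₀)²` at `k = 1` — the `p = 4` of `…AveragedCurlFormSplit.kappa1_le_thirteen`)

Cell `pub-balaban`, sub-cell `t4`, spine estimate NE7b (`T4WeightBudget.RelWeightBound`; the cell's OWN estimate — NOT PRINTED in
[Bałaban 1983–89], NOT PROVED).  Crux-route work under `Spine/NE7b/` by the row's E-side ∕ key-readings ∕ lattice-geometry leaf lineage; a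
[folklore] rescaling BY NAME of this lineage's `…OneStepCurlFormDisplay` (same hypotheses verbatim); NOTHING of Bałaban's is asserted beyond what
that module proves; no `T4Continuum/Support` leaf typed; no `def`, no notation, no instance; zero `sorry`.

THE DICTIONARY (k = 1).  Fine lattice `ηℤ^d`, `η = L⁻¹`, read on `ℤ^d`; the fine configuration `U = V₀·e^{W}` with the LATTICE 1-form `W = ηA`
(print's `U^u = e^{iηA₀}`, [B9] (3.35)); the unit-lattice (coarse) field of the linear one-step average is [B7]'s `L(Q(V₀)W)_c = linQcov L V₀ W`
((122); `= L·(Q₀W)_c +` remainder, (125)–(126)), i.e. `L •` the unit-normalised `Q W` of `…OneStepCurlFormDisplay`; the linearised covariant fine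
curl `(R_{0,y}W)(∂p) = η²·(D_UA)(p)` and `W(b) = η·A(b)`, so `‖D_UA‖²_{L²(η)} = η^d Σ_p ‖(D_UA)(p)‖² = L^{−d} Σ_q (L²·Fq q)²` and `‖A‖²_{L²(η)} =
L^{−d} Σ_b (L·Ab b)²` in the torus sizes `Fq`, `Ab` of `W` (characterising hypotheses `hF`, `hA` verbatim).

WHAT IS PROVED ([folklore]):
* §1 `X_smul` — the covariant coarse curl functional is absolutely homogeneous: `X_P(c • B) = |c|·X_P(B)` (`conjR_smul_real`, `norm_smul`);
  `X_linQcov_eq` — `X_P(B) = L·X_P(L⁻¹ • B)` for the un-normalised average `B = (y,κ) ↦ linQcov L V₀ W (qb y) κ`.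
* §2 `sum_sq_eta_curl`, `sum_sq_eta_field` — the two size identities `Σ_q Fq q² = L^{d−4}·(L^{−d}Σ_q (L²Fq q)²)`, `Σ_b Ab b² = L^{d−2}·(L^{−d}Σ_b (L·Ab b)²)`.
* §3 **`sum_sq_X_linQcov_eta_le`** — THE DISPLAY IN `η`-UNITS:
  `Σ_P X_P(B)² ≤ 4(1+2Lα₀)²·(L^{−d}Σ_q (L²Fq q)²) + (8(d−1)(L+2)²ε₁² + 32d(d−1)L^d(50(d+1)ε₂)²)·(L^{−d}Σ_b (L·Ab b)²)`,
  `ε₁ = 2L(L+1)α₀ + 1920(d+1)(d+4)L²α₀`, `ε₂ = 16(d+1)(d+4)L²α₀`.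

HONEST SHAPE ∕ BY VALUE.  `p = 4(1+2Lα₀)²` is the `L²(η)`-normalised curl constant at `k = 1` (print's `16` from its `p_M = 8`; the memo's own sharp
remark `4`; `…AveragedCurlFormSplit.kappa1_le_thirteen` assumed exactly `p = 4`): at the smallness edge `2Lα₀ ≤ 2∕(512·(d+1)(d+4)L) ≤ 10⁻³`, so
`p ≤ 4.01`.  `q = 8(d−1)(L+2)²ε₁² + 32d(d−1)L^d(50(d+1)ε₂)²` carries an HONEST `L^d` in its (R-M) part (the one-bond trunk witness, refuter ι-G93-RM-1
∕ leaf-01 R-RM-leaf01-g84-1: at `k = 1` the all-`A` (R-M) letter's `c_E²` is `≳ ε²L^d`); at `d = 4`, `L = 2`: `q = 384ε₁² + 3.84·10⁸ε₂² ≈ (3.6·10¹³ +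
2.5·10¹⁵)·α₀²`, `≤ 1` iff `α₀ ≲ 2·10⁻⁸` — print's «`c₃c₀ε_F² ≤ 2`» regime.  NOT HERE: CED's `h1_of_letters` junction itself (matrix currency: a real
coordinatisation of the `𝔸`-valued forms — (A3)-type identification, NC-NE7b-α UNRULED), (3.4) ∕ `κ₁, κ₂` by value, `k > 1`, anything of Bałaban's.
BY-NAME EFFECT ON THE WALL: NONE (the (h1) slot's `hF` letter at `k = 1` in print's units; the wall is (R2)).  NE7b NOT PRINTED ∕ NOT PROVED; spine
PROVED 0∕9; rung (B)+1 on a FINITE torus — NOT infinite volume, NOT the mass gap, NOT Clay.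
HONEST DEPENDENCY: continuum YM on T⁴ ⇐ BetaPertH ∧ nine spine estimates (0/9 proved); BetaPertH ⇐ (D1) ∧ (D4) ∧ CAP+tail; G-an2-4 gates
asym, D1 and NE2/3/4.
-/

set_option autoImplicit false

noncomputable section

open scoped BigOperators
open Finset
open Literature.MathematicalPhysics.QuantumFieldTheory.Balaban1983to89
open Literature.MathematicalPhysics.QuantumFieldTheory.Balaban1983to89 (GaugeGroup dist1)
open Literature.MathematicalPhysics.QuantumFieldTheory.Balaban1983to89.B7Prop1Explicit (Site e hol bavg plaqWord)
open Literature.MathematicalPhysics.QuantumFieldTheory.Balaban1983to89.B7Prop2Explicit (unitaryUnits)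
open Literature.MathematicalPhysics.QuantumFieldTheory.Balaban1983to89.B7Eq78Linearization (conjR conjR_smul_real)
open Literature.MathematicalPhysics.QuantumFieldTheory.Balaban1983to89.B7Prop3GeneralRotated (tsum)
open Literature.MathematicalPhysics.QuantumFieldTheory.Balaban1983to89.B7Prop3GeneralLinear (linQcov)
open Literature.MathematicalPhysics.QuantumFieldTheory.Balaban1983to89.T4TermwiseTorus (tcls IsPeriodic)

namespace Summit.QuantumFields.BalabanUV.T4Continuum.NE7b.OneStepCurlFormDisplayEta

variable {d : ℕ}
variable {𝔸 : Type*} [CStarAlgebra 𝔸] [Nontrivial 𝔸] {G : Type*} [GaugeGroup G]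
  (ι : G →* 𝔸ˣ) (hιu : ∀ g, ι g ∈ unitaryUnits 𝔸) (hdist : ∀ g, ‖((ι g : 𝔸ˣ) : 𝔸) - 1‖ = dist1 g)
  (L M : ℕ) [NeZero M] [NeZero (L * M)] [Fact (1 < M)] (hL : 1 ≤ L) {α₀ : ℝ} (hα₀ : 0 ≤ α₀)
  (hsmall : 512 * (d + 1) * (d + 4) * (L : ℝ) ^ 2 * α₀ ≤ 1)
  (U : Site d → Fin d → G) {V₀ : Site d → Fin d → 𝔸ˣ} (hV₀ : ∀ y ν, V₀ y ν = ι (U y ν))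
  (h44 : ∀ (x : Site d) (κ κ' : Fin d), κ ≠ κ' → ‖((hol V₀ x (plaqWord κ κ') : 𝔸ˣ) : 𝔸) - 1‖ ≤ α₀)
  (hVper : IsPeriodic (L * M) V₀)
  (W : Site d → Fin d → 𝔸) (hWper : IsPeriodic (L * M) W)
  (qb : (Fin d → ZMod M) → Site d) (hqb : ∀ y i, qb y i = (L : ℤ) * (((y i).val : ℕ) : ℤ))
  (ι4 : (Fin d → ZMod M) × {a : Fin d × Fin d // a.1 < a.2} → Fin 4 → (Fin d → ZMod M) × Fin d)
  (hι4 : ∀ x a, ι4 (x, a) = ![(x, a.1.1), (x + Pi.single a.1.1 1, a.1.2), (x + Pi.single a.1.2 1, a.1.1), (x, a.1.2)])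
  (X : (Fin d → ZMod M) × {a : Fin d × Fin d // a.1 < a.2} → ((Fin d → ZMod M) → Fin d → 𝔸) → ℝ)
  (hX : ∀ (y : Fin d → ZMod M) (a : {a : Fin d × Fin d // a.1 < a.2}) (B : (Fin d → ZMod M) → Fin d → 𝔸), X (y, a) B =
    ‖B y a.1.1 + conjR (bavg L V₀ (qb y) a.1.1) (B (y + Pi.single a.1.1 1) a.1.2)
      - conjR (bavg L V₀ (qb y) a.1.1 * bavg L V₀ (qb y + (L : ℤ) • e a.1.1) a.1.2 * (bavg L V₀ (qb y + (L : ℤ) • e a.1.2) a.1.1)⁻¹)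
          (B (y + Pi.single a.1.2 1) a.1.1)
      - conjR (bavg L V₀ (qb y) a.1.1 * bavg L V₀ (qb y + (L : ℤ) • e a.1.1) a.1.2 * (bavg L V₀ (qb y + (L : ℤ) • e a.1.2) a.1.1)⁻¹
          * (bavg L V₀ (qb y) a.1.2)⁻¹) (B y a.1.2)‖)
  (Fq : (Fin d → ZMod (L * M)) × {a : Fin d × Fin d // a.1 < a.2} → ℝ)
  (hF : ∀ (y : Site d) (a : {a : Fin d × Fin d // a.1 < a.2}), Fq (tcls (L * M) y, a) = ‖tsum V₀ W y (plaqWord a.1.1 a.1.2)‖)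
  (Ab : (Fin d → ZMod (L * M)) × Fin d → ℝ) (hA : ∀ (y : Site d) (ν : Fin d), Ab (tcls (L * M) y, ν) = ‖W y ν‖)

/-! ## §1 The curl functional is absolutely homogeneous -/

include hX in
omit [Nontrivial 𝔸] [NeZero M] [NeZero (L * M)] [Fact (1 < M)] in
/-- **`X_P(c • B) = |c|·X_P(B)`** for real `c` (the rotations are real-linear: `conjR_smul_real`). [folklore] -/
theorem X_smul (c : ℝ) (P : (Fin d → ZMod M) × {a : Fin d × Fin d // a.1 < a.2}) (B : (Fin d → ZMod M) → Fin d → 𝔸) :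
    X P (c • B) = |c| * X P B := by
  obtain ⟨y, a⟩ := P
  rw [hX, hX]
  simp only [Pi.smul_apply, conjR_smul_real, ← smul_add, ← smul_sub, norm_smul, Real.norm_eq_abs]

include hX hL in
omit [Nontrivial 𝔸] [NeZero M] [NeZero (L * M)] [Fact (1 < M)] in
/-- **THE UN-NORMALISED AVERAGE IS `L •` THE NORMALISED ONE UNDER `X`**: `X_P((y,κ) ↦ linQcov …) = L·X_P((y,κ) ↦ L⁻¹ • linQcov …)`. [folklore] -/
theorem X_linQcov_eq (P : (Fin d → ZMod M) × {a : Fin d × Fin d // a.1 < a.2}) :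
    X P (fun y κ => linQcov L V₀ W (qb y) κ) = (L : ℝ) * X P (fun y κ => (L : ℝ)⁻¹ • linQcov L V₀ W (qb y) κ) := by
  have hLpos : (0 : ℝ) < L := by exact_mod_cast hL
  have hfun : (fun y κ => linQcov L V₀ W (qb y) κ) = (L : ℝ) • (fun y κ => (L : ℝ)⁻¹ • linQcov L V₀ W (qb y) κ) := by
    funext y κ
    simp only [Pi.smul_apply, smul_smul, mul_inv_cancel₀ hLpos.ne', one_smul]
  rw [hfun, X_smul L M qb X hX, abs_of_pos hLpos]

/-! ## §2 The two size identities of the `η`-normalisation (`η = L⁻¹`) -/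

omit [NeZero M] [Fact (1 < M)] in
/-- `Σ_q Fq q² = L^{d−4}·(L^{−d} Σ_q (L² Fq q)²)` — `‖D_UA‖²_{L²(η)} = L^{−d}Σ_q (L²Fq q)²` for `W = ηA`. [folklore] -/
theorem sum_sq_eta_curl (hL : 1 ≤ L) :
    ∑ q, Fq q ^ 2 = ((L : ℝ) ^ 4)⁻¹ * (L : ℝ) ^ d * ((1 / (L : ℝ) ^ d) * ∑ q, ((L : ℝ) ^ 2 * Fq q) ^ 2) := by
  have hLpos : (0 : ℝ) < L := by exact_mod_cast hL
  have hLd : (L : ℝ) ^ d ≠ 0 := pow_ne_zero _ hLpos.ne'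
  have hL4 : (L : ℝ) ^ 4 ≠ 0 := pow_ne_zero _ hLpos.ne'
  have hre : ∑ q, ((L : ℝ) ^ 2 * Fq q) ^ 2 = (L : ℝ) ^ 4 * ∑ q, Fq q ^ 2 := by
    rw [Finset.mul_sum]; exact Finset.sum_congr rfl fun q _ => by ring
  rw [hre]
  field_simp

omit [NeZero M] [NeZero (L * M)] [Fact (1 < M)] in
/-- `Σ_b Ab b² = L^{d−2}·(L^{−d} Σ_b (L·Ab b)²)` — `‖A‖²_{L²(η)} = L^{−d}Σ_b (L·Ab b)²` for `W = ηA`. [folklore] -/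
theorem sum_sq_eta_field [NeZero (L * M)] (hL : 1 ≤ L) :
    ∑ b, Ab b ^ 2 = ((L : ℝ) ^ 2)⁻¹ * (L : ℝ) ^ d * ((1 / (L : ℝ) ^ d) * ∑ b, ((L : ℝ) * Ab b) ^ 2) := by
  have hLpos : (0 : ℝ) < L := by exact_mod_cast hL
  have hLd : (L : ℝ) ^ d ≠ 0 := pow_ne_zero _ hLpos.ne'
  have hL2 : (L : ℝ) ^ 2 ≠ 0 := pow_ne_zero _ hLpos.ne'
  have hre : ∑ b, ((L : ℝ) * Ab b) ^ 2 = (L : ℝ) ^ 2 * ∑ b, Ab b ^ 2 := by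
    rw [Finset.mul_sum]; exact Finset.sum_congr rfl fun b _ => by ring
  rw [hre]
  field_simp

/-! ## §3 The display in `η`-units -/

include hιu hdist hL hα₀ hsmall hV₀ h44 hVper hWper hqb hι4 hX hF hA in
/-- **PROP. 5.4, FIRST DISPLAY, AT `k = 1`, IN PRINT's `η`-UNITS** (`η = L⁻¹`, `B = L(Q(V₀)W)` the unit-lattice field, `W = ηA`):
`Σ_P X_P(B)² ≤ 4(1+2Lα₀)²·(L^{−d}Σ_q (L²Fq q)²) + (8(d−1)(L+2)²ε₁² + 32d(d−1)L^d(50(d+1)ε₂)²)·(L^{−d}Σ_b (L·Ab b)²)` — the `hF` letter `(p, q)` of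
`…CurlFormEnergyDomination.h1_of_letters` at one step with `p = 4(1+2Lα₀)²`. [folklore] -/
theorem sum_sq_X_linQcov_eta_le (hd : 1 ≤ d) :
    ∑ P, X P (fun y κ => linQcov L V₀ W (qb y) κ) ^ 2
      ≤ 4 * (1 + 2 * ((L : ℝ) * α₀)) ^ 2 * ((1 / (L : ℝ) ^ d) * ∑ q, ((L : ℝ) ^ 2 * Fq q) ^ 2)
        + (8 * ((d : ℝ) - 1) * ((L : ℝ) + 2) ^ 2
              * (2 * (L : ℝ) * ((L : ℝ) + 1) * α₀ + 1920 * (d + 1) * (d + 4) * (L : ℝ) ^ 2 * α₀) ^ 2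
            + 32 * d * ((d : ℝ) - 1) * (L : ℝ) ^ d * (50 * (d + 1) * (16 * (d + 1) * (d + 4) * (L : ℝ) ^ 2 * α₀)) ^ 2)
          * ((1 / (L : ℝ) ^ d) * ∑ b, ((L : ℝ) * Ab b) ^ 2) := by
  have hLpos : (0 : ℝ) < L := by exact_mod_cast hL
  have hLd : (L : ℝ) ^ d ≠ 0 := pow_ne_zero _ hLpos.ne'
  have h := OneStepCurlFormDisplay.sum_sq_X_linQcov_le' ι hιu hdist L M hL hα₀ hsmall U hV₀ h44 hVper W hWper qb hqb ι4 hι4 X hX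
    Fq hF Ab hA hd
  -- rescale the left side by `L²` and the two size sums by `L^{d−4}`, `L^{d−2}`
  have hlhs : ∑ P, X P (fun y κ => linQcov L V₀ W (qb y) κ) ^ 2
      = (L : ℝ) ^ 2 * ∑ P, X P (fun y κ => (L : ℝ)⁻¹ • linQcov L V₀ W (qb y) κ) ^ 2 := by
    rw [Finset.mul_sum]
    exact Finset.sum_congr rfl fun P _ => by rw [X_linQcov_eq L M hL W qb X hX P]; ring
  rw [hlhs, sum_sq_eta_curl L M Fq hL, sum_sq_eta_field L M Ab hL] at *
  set D2 := (1 / (L : ℝ) ^ d) * ∑ q, ((L : ℝ) ^ 2 * Fq q) ^ 2 with hD2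
  set N2 := (1 / (L : ℝ) ^ d) * ∑ b, ((L : ℝ) * Ab b) ^ 2 with hN2
  have hD0 : 0 ≤ D2 := by positivity
  have hN0 : 0 ≤ N2 := by positivity
  have h2 := mul_le_mul_of_nonneg_left h (sq_nonneg (L : ℝ))
  refine h2.trans (le_of_eq ?_)
  have hd1 : ((L : ℝ) ^ d) = (L : ℝ) ^ (d - 1) * L := by
    rw [← pow_succ]; congr 1; omega
  field_simp
  ring

end Summit.QuantumFields.BalabanUV.T4Continuum.NE7b.OneStepCurlFormDisplayEta

end
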